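import Summits.NavierStokesRegularity.NavierStokesRegularity.Theses.RellichScar
import Summits.NavierStokesRegularity.NavierStokesRegularity.Theorems.SqueezeCycleRecurrentLiouvilleRellichScarResidue

/-!
# Crux-strategist r1 sketch — `RellichScar.ApexLocalisation` (stmt-NavierStokesRegularity-11719)

Typed forms of the STRENGTHEN / DECOMPOSITION attempts of the r1 (second-opinion) census
`STRATEGY-CENSUS.md` (seat planner-cstrat-stmt-NavierStokesRegularity-11719-r1-0, 2026-08-17).
Nothing here is a registered line. The file certifies that the candidate statements elaborate,
that the one two-open-piece split found (`IsolatedSelection ∧ IsolatedUpgrade`) assembles to the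
crux by pure logic, and that BOTH of its pieces are consequences of the crux (so the split is a
factorisation of the crux through the sub-class "0 is an isolated final-time singular point",
honest in shape, but — see the census — without an engine on either side).

* `IsolatedSelection`  (Sel, Cantor–Bendixson side): a rate profile singular at the origin yields a
  rate profile singular at the origin whose origin is ISOLATED among final-time singular points.
* `IsolatedUpgrade`    (Upg): an origin-isolated rate profile yields an APEX profile.
* `apexLocalisation_of_isolated_split : IsolatedSelection → IsolatedUpgrade → ApexLocalisation`.
* `isolatedUpgrade_of_apexLocalisation : ApexLocalisation → IsolatedUpgrade` (Upg is a crux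
  consequence; so is Sel, via the landed `finalSliceSingularSet_eq_of_apex`, not re-proved here).
* `UniformlyPerfectDustLiouville` (S⁺₆): the set-theoretic normal form of the residual enemy made
  rigid — no origin-singular rate profile with `𝐈 < ⊤` has a final-time singular set that is
  uniformly perfect (constant `a`) at every singular point and every scale. Open, mechanism-free.
* `FarFieldTameness` (S⁺₇, blow-down side): a rate profile with BOUNDED final-time singular set is
  scale-invariantly tame at spatial infinity. Open; its enemy is the far-field flare tower.
-/

noncomputable section
set_option linter.dupNamespace false

open MeasureTheory Set Function Filter Topology
open scoped ENNReal InnerProductSpace RealInnerProductSpace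
open Literature.Analysis.FluidPDE
open Summit.NavierStokesRegularity.NavierStokesRegularity.Theses

namespace Summit.NavierStokesRegularity.NavierStokesRegularity.Cruxes.ApexLocalisation.StrategistR1

/-- Physical space. -/
local notation "E³" => EuclideanSpace ℝ (Fin 3)

/-- The open backward slab `(-∞,0) × ℝ³` (time first), as in the route file. -/
local notation "𝕊" => Literature.Analysis.FluidPDE.slab (EuclideanSpace ℝ (Fin 3)) (Set.Iio (0 : ℝ)) isOpen_Iio

/-- The rate class of the crux antecedent, bundled (verbatim the five conjuncts of
`RellichScar.ApexLocalisation`'s hypothesis). -/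
def InRateClassSingular (C : ℝ) (u : ℝ → E³ → E³) (p : ℝ → E³ → ℝ) (G : ℝ → E³ → E³ →L[ℝ] E³) :
    Prop :=
  IsSuitableWeakSolutionOn 𝕊 1 0 u p ∧ HasWeakSpatialGradientOn 𝕊 u G ∧
    typeIBound (Set.Iio (0 : ℝ) ×ˢ Set.univ) u p G < ⊤ ∧ HasTypeITimeDecay C u ∧
    IsBackwardSingularPoint u 0

/-- The apex class of the crux conclusion, bundled (verbatim). -/
def InApexClassSingular (C : ℝ) (u : ℝ → E³ → E³) (p : ℝ → E³ → ℝ) (G : ℝ → E³ → E³ →L[ℝ] E³) :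
    Prop :=
  IsSuitableWeakSolutionOn 𝕊 1 0 u p ∧ HasWeakSpatialGradientOn 𝕊 u G ∧
    typeIBound (Set.Iio (0 : ℝ) ×ˢ Set.univ) u p G < ⊤ ∧ HasTypeIDecay C u ∧
    IsBackwardSingularPoint u 0

/-- "The origin is an isolated final-time singular point at scale `r`": no backward-singular point
`(0, x)` with `0 < ‖x‖ ≤ r`. (All singular points of a rate profile lie on the final slice.) -/
def OriginIsolated (r : ℝ) (u : ℝ → E³ → E³) : Prop :=
  ∀ x : E³, 0 < ‖x‖ → ‖x‖ ≤ r → ¬ IsBackwardSingularPoint u ((0 : ℝ), x)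

/-- The crux, restated over the bundles (definitionally the route decl, see `crux_iff`). -/
theorem crux_iff :
    RellichScar.ApexLocalisation ↔
      ∀ C : ℝ, (∃ u p G, InRateClassSingular C u p G) → ∃ C' u p G, InApexClassSingular C' u p G :=
  Iff.rfl

/-- **Sel (`IsolatedSelection`)**: if an origin-singular rate profile exists, then one exists whose
origin is an isolated final-time singular point at some scale. Free when some orbit-closure member
has a COUNTABLE final-time singular set near `0` (Cantor–Bendixson: a nonempty countable compact set
has an isolated point; translate there); fails only against profiles all of whose companions have
PERFECT final-time singular sets — the uniformly-perfect dust (`UniformlyPerfectDustLiouville`). -/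
def IsolatedSelection : Prop :=
  ∀ C : ℝ, (∃ u p G, InRateClassSingular C u p G) →
    ∃ (C'' r : ℝ) (u : ℝ → E³ → E³) (p : ℝ → E³ → ℝ) (G : ℝ → E³ → E³ →L[ℝ] E³),
      0 < r ∧ InRateClassSingular C'' u p G ∧ OriginIsolated r u

/-- **Upg (`IsolatedUpgrade`)**: an origin-singular rate profile whose origin is an isolated
final-time singular point yields an apex profile. Its enemy is the FLARE TOWER: regular points
`x_k → 0` carrying scale-invariant amplitude `‖x_k‖ · sup_{t ∈ (-‖x_k‖²,0)} ‖u(x_k,t)‖ → ∞`, which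
nucleate singular points on the unit sphere of a zoom limit. -/
def IsolatedUpgrade : Prop :=
  ∀ C r : ℝ, 0 < r → (∃ u p G, InRateClassSingular C u p G ∧ OriginIsolated r u) →
    ∃ C' u p G, InApexClassSingular C' u p G

/-- The split assembles to the crux by pure logic (this is the `…_of_subs` glue a
`route edit --split` would need; it is NOT filed — see the census, §Decomposition). -/
theorem apexLocalisation_of_isolated_split (hSel : IsolatedSelection) (hUpg : IsolatedUpgrade) :
    RellichScar.ApexLocalisation := by
  rw [crux_iff]
  intro C hC
  obtain ⟨C'', r, u, p, G, hr, hrate, hiso⟩ := hSel C hC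
  exact hUpg C'' r hr ⟨u, p, G, hrate, hiso⟩

/-- Upg is a consequence of the crux (the isolated class is a sub-class of the rate class). -/
theorem isolatedUpgrade_of_apexLocalisation (h : RellichScar.ApexLocalisation) : IsolatedUpgrade := by
  intro C r _ hex
  obtain ⟨u, p, G, hrate, _⟩ := hex
  exact (crux_iff.1 h) C ⟨u, p, G, hrate⟩

/-- Uniform perfectness of the final-time singular set at every singular point and EVERY scale,
with constant `a ∈ (0,1)`: each singular `(0,x)` has a singular `(0,y)` with
`a r ≤ ‖y - x‖ ≤ r`, for every `r > 0` (the beads-on-a-ray / self-similar Cantor dust satisfy it). -/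
def SingularSetUniformlyPerfect (a : ℝ) (u : ℝ → E³ → E³) : Prop :=
  ∀ x : E³, IsBackwardSingularPoint u ((0 : ℝ), x) → ∀ r : ℝ, 0 < r →
    ∃ y : E³, IsBackwardSingularPoint u ((0 : ℝ), y) ∧ a * r ≤ ‖y - x‖ ∧ ‖y - x‖ ≤ r

/-- **S⁺₆ `UniformlyPerfectDustLiouville`**: no origin-singular rate profile with `𝐈 < ⊤` has a
uniformly perfect final-time singular set. A Liouville statement over the rigid residual enemy;
(L)-vacuous; no known Navier–Stokes estimate sees LOWER (Assouad) dimension, so: open,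
mechanism-free. -/
def UniformlyPerfectDustLiouville : Prop :=
  ∀ (C a : ℝ), 0 < a → a < 1 →
    ∀ (u : ℝ → E³ → E³) (p : ℝ → E³ → ℝ) (G : ℝ → E³ → E³ →L[ℝ] E³),
      InRateClassSingular C u p G → ¬ SingularSetUniformlyPerfect a u

/-- **S⁺₇ `FarFieldTameness`** (blow-down side): an origin-singular rate profile whose final-time
singular set is BOUNDED is scale-invariantly tame at spatial infinity (then its blow-downs are apex
by `shellUniformityGivesApex`-type bookkeeping). Enemy: far-field flare towers. Open. -/
def FarFieldTameness : Prop :=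
  ∀ (C R : ℝ) (u : ℝ → E³ → E³) (p : ℝ → E³ → ℝ) (G : ℝ → E³ → E³ →L[ℝ] E³),
    InRateClassSingular C u p G → (∀ x : E³, R ≤ ‖x‖ → ¬ IsBackwardSingularPoint u ((0 : ℝ), x)) →
    ∃ K R' : ℝ, ∀ t : ℝ, t < 0 → ∀ x : E³, R' ≤ ‖x‖ → ‖x‖ * ‖u t x‖ ≤ K

/-- Sanity for S⁺₇: an apex profile is far-field tame with `K = C'`, `R' = 0`
(`‖x‖·‖u‖ ≤ ‖x‖·C'/(‖x‖+√(−t)) ≤ C'` for `0 ≤ C'`). -/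
example {u : ℝ → E³ → E³} {C' : ℝ} (hC' : 0 ≤ C') (h : HasTypeIDecay C' u) :
    ∃ K R' : ℝ, ∀ t : ℝ, t < 0 → ∀ x : E³, R' ≤ ‖x‖ → ‖x‖ * ‖u t x‖ ≤ K := by
  refine ⟨C', 0, fun t ht x _ => ?_⟩
  have hs : 0 < Real.sqrt (-t) := Real.sqrt_pos.2 (by linarith)
  have hden : 0 < ‖x‖ + Real.sqrt (-t) := add_pos_of_nonneg_of_pos (norm_nonneg _) hs
  have hx := h t ht x
  calc ‖x‖ * ‖u t x‖ ≤ ‖x‖ * (C' / (‖x‖ + Real.sqrt (-t))) := by gcongr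
    _ = C' * (‖x‖ / (‖x‖ + Real.sqrt (-t))) := by ring
    _ ≤ C' * 1 := by
        gcongr
        rw [div_le_one hden]
        linarith [hs.le]
    _ = C' := mul_one _

/-! ## Node position (for the tribunal): by landed theorems, given the route's own target
`NoApexTypeIProfile` (item 11716) the crux IS stmt-1588 `NoTypeIRateProfile` (≡ stmt-1589
`RecurrentLiouville`); unconditionally stmt-1588 ⇒ crux. One-line corollaries of
`Theorems.noTypeIRateProfile_iff_rellichScar` (SqueezeCycleRecurrentLiouvilleRellichScarResidue). -/

/-- stmt-1588 closes the crux outright. -/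
theorem apexLocalisation_of_noTypeIRateProfile (h : RecurrentProfiles.NoTypeIRateProfile) :
    RellichScar.ApexLocalisation :=
  (Theorems.noTypeIRateProfile_iff_rellichScar.1 h).2

/-- Given the route target X (11716), the crux is EQUIVALENT to stmt-1588. -/
theorem apexLocalisation_iff_noTypeIRateProfile_of_target (hX : RellichScar.NoApexTypeIProfile) :
    RellichScar.ApexLocalisation ↔ RecurrentProfiles.NoTypeIRateProfile :=
  ⟨fun hA => Theorems.noTypeIRateProfile_iff_rellichScar.2 ⟨hX, hA⟩,
    apexLocalisation_of_noTypeIRateProfile⟩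

/-- … and to stmt-1589 `RecurrentLiouville` (route RecurrentProfiles / SqueezeCycle). -/
theorem apexLocalisation_iff_recurrentLiouville_of_target (hX : RellichScar.NoApexTypeIProfile) :
    RellichScar.ApexLocalisation ↔ SqueezeCycle.RecurrentLiouville :=
  ⟨fun hA => Theorems.recurrentLiouville_iff_rellichScar.2 ⟨hX, hA⟩,
    fun hL => (Theorems.recurrentLiouville_iff_rellichScar.1 hL).2⟩

end Summit.NavierStokesRegularity.NavierStokesRegularity.Cruxes.ApexLocalisation.StrategistR1
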